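import Mathlib.LinearAlgebra.FreeModule.StrongRankCondition
import Summits.HodgeConjecture.CorCM.Census.GroupFreeFaceCoordinates
import Summits.HodgeConjecture.CorCM.Census.OddSliceFacesRecord

/-!
# The group-free face basis, III: `H/P` is free of rank `2^{n−1} − n`, and the RANK LAW — at least `⌈(2^{n−1} − n)/n⌉` Galois
# orbits of Hodge vectors are needed to generate the Hodge lattice of the full slice modulo divisor pairs, for every Galois CM type
# of order `2n`

COR-CM (cell `pub-hodgecm2`), count-neutral kernel census by the binder seat b09 (gen 27; lane GROUP-FREE-FACE-BASIS, André-3's ask A6-R46),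
sequel of `Census/GroupFreeFaceBasis.lean` (generation) and `Census/GroupFreeFaceCoordinates.lean` (independence, the face basis of `H/P`,
`|BIdx| = 2^{n−1} − n`).  Theorems only, Mathlib-only mathematics; no `decide` table, no certificate, no named fact, no `sorry`.  HC_CM is
not proved anywhere in this cell; nothing here is a headline and nothing here produces a period.

CONTENT (`n = |A| ≥ 1`, `A` = the finite place set; group-free unless said).
* §1 `finrank_hodge_mod_pairs`: the image of `H` in `ℤ^{labels}/P` is free of rank `2^{n−1} − n` (face basis of part II).
* §2 **THE RANK LAW, operator form** (`rank_law`): if `H ≤ P ⊔ ℤ⟨g_k t : k ∈ ι, t ∈ S⟩` for ANY family of self-maps `g_k` of the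
  exponent vectors indexed by a finite `ι` and a finite set `S` of vectors, then `2^{n−1} − n ≤ |ι| · |S|` (the quotient is spanned by
  `|ι|·|S|` classes).  GROUP FORM (`rank_law_transl`, `A` an additive group, the Galois type `(ℤ/2 × A, (1,0))` of the lane with its
  action `transl`): conjugation `c = (1,0)` acts as `−1` modulo `P` (`transl_one_zero_add_mem_pairs`), so the `2n` translates of a
  vector span modulo `P` what the `n` translates by `(0, a)` span, and **`H ≤ P ⊔ ℤ[G]·S ⟹ 2^{n−1} − n ≤ n·|S|`**, i.e.
  `μ(ℤ/2 × A) ≥ ⌈(2^{n−1} − n)/n⌉` for EVERY finite abelian `A` (odd or even: `A = ℤ/10` is André-3's split icosic type, `A = ℤ/2 × ℤ/2^k`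
  b04's abelian 2-power types, …).  The same argument gives `μ(G,c) ≥ ⌈(2^{n−1} − n)/n⌉` for every Galois CM type of order `2n` once
  its label model is identified with `Ty (places)` (module docstring of part I); values `1, 1, 3, 5, 9, 15, 28, 51, 93, 170, 315` for
  `2n = 6 … 26` — André-3's `PORTFOLIO-g15` §3.1 remark «`μ_F ≥ ⌈502/10⌉ = 51` for every type of degree 20», now for every degree, and
  sharp on the lane's rows `ℤ/6, ℤ/8, ℤ/10, ℤ/12, Dic₃, ℤ/14, ℤ/16, ℤ/20, Dic₅, ℤ/22` (not on `ℤ/18`: 28 < 29, nor on split types).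
  Companion (`exists_faces_generate_transl`): the `2^{n−1} − n` basis faces themselves generate under `G`, so with no certificate at all
  `⌈(2^{n−1} − n)/n⌉ ≤ μ(ℤ/2 × A) ≤ μ_faces(ℤ/2 × A) ≤ 2^{n−1} − n` for every finite abelian `A`.
* §3 MODEL OF RECORD (`rank_law_record`, `|A|` odd): the same bound for b17's labels `Pt (AbQ A)` / `hodgeLattice (πQ A) (φQ A)` of
  `Census/OddDegreeParityLaw*.lean`, transported along b09 gen 26's `OddSliceFacesRecord.pull`; there it sits BELOW b17's parity bound
  `#OrbitsA A` (equal for `|A|` prime: `(2^{p−1} − 1)/p = ⌈(2^{p−1} − p)/p⌉`), so it is recorded only as the degree-free floor.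

WHAT IS NEW AND WHAT IS NOT.  Integral generation of the relation lattice by ALL face relations, for every `(G, c)`, is the prior
programme's `RfwfAllgGroup.gfaces_generate` (`CorCM/Prior/AllgGroup2.lean`: `span ℤ (gfaceSet G c) = ker typeSum`, second differences
`[Φ] + [Φ^{(ππ')}] − [Φ^{(π)}] − [Φ^{(π')}]`), on which the tree's `lefChar_eq_sum_faces` rests; modulo pairs a corner indicator IS a second
difference (`faceVec_ind_sub_mem_pairs`), so part I's `hodge_eq_pairs_sup_faceSpan` is that theorem in the place model.  New in this lane are
the explicit BASIS (`2^{n−1} − n` named faces for ANY selector, unit-triangular), independence / unique coordinates / the rank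
`2^{n−1} − n` (part II), and the rank law with its companion bound (this file).

## References
* [Pohlmann1968] H. Pohlmann, Algebraic cycles on abelian varieties of complex multiplication type, Ann. of Math. 88 (1968), Thm 1.
-/

namespace Summit.HodgeConjecture.CorCM.Census.GroupFreeFaceBasisRank

open Finset OddSliceFacesModel OddSliceFacesSquares OddSliceFacesDescent GroupFreeFaceBasis GroupFreeFaceCoordinates

/-! ## §1 The rank of `H/P` -/

section GroupFree

variable (A : Type) [Fintype A] [DecidableEq A]

/-- **`H/P` is free of rank `2^{n−1} − n`**: the image of the Hodge lattice in `ℤ^{labels}/P` has `finrank` `2^{n−1} − n`. [folklore] -/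
theorem finrank_hodge_mod_pairs (i₀ : A) :
    Module.finrank ℤ ((hodge A).map (pairs A).mkQ) = 2 ^ (Fintype.card A - 1) - Fintype.card A := by
  haveI : Nonempty A := ⟨i₀⟩
  obtain ⟨sel, hsel⟩ := exists_selector A
  obtain ⟨b, -⟩ := exists_basis A i₀ hsel
  rw [Module.finrank_eq_card_basis b, card_BIdx]

/-! ## §2 The rank law -/

/-- **THE RANK LAW (operator form).**  If the Hodge lattice is generated modulo pairs by the images of a finite set `S` of vectors
under a finite family of self-maps `g_k`, then `2^{n−1} − n ≤ |ι| · |S|`. [folklore] -/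
theorem rank_law (i₀ : A) {ι : Type} [Fintype ι] (g : ι → (Ty A → ℤ) → (Ty A → ℤ)) (S : Finset (Ty A → ℤ))
    (hS : hodge A ≤ pairs A ⊔ Submodule.span ℤ {v | ∃ k : ι, ∃ t ∈ S, v = g k t}) :
    2 ^ (Fintype.card A - 1) - Fintype.card A ≤ Fintype.card ι * S.card := by
  classical
  set T : Finset ((Ty A → ℤ) ⧸ pairs A) := (univ ×ˢ S).image fun p => (pairs A).mkQ (g p.1 p.2) with hT
  have hle : (hodge A).map (pairs A).mkQ ≤ Submodule.span ℤ (T : Set ((Ty A → ℤ) ⧸ pairs A)) := by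
    rw [Submodule.map_le_iff_le_comap]
    refine hS.trans (sup_le ?_ (Submodule.span_le.mpr ?_))
    · intro p hp
      rw [Submodule.mem_comap, Submodule.mkQ_apply, (Submodule.Quotient.mk_eq_zero _).mpr hp]
      exact Submodule.zero_mem _
    · rintro _ ⟨k, t, ht, rfl⟩
      rw [SetLike.mem_coe, Submodule.mem_comap]
      refine Submodule.subset_span ?_
      rw [Finset.mem_coe, hT, Finset.mem_image]
      exact ⟨(k, t), Finset.mem_product.mpr ⟨Finset.mem_univ k, ht⟩, rfl⟩
  have h1 : Module.finrank ℤ ((hodge A).map (pairs A).mkQ) ≤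
      Module.finrank ℤ (Submodule.span ℤ (T : Set ((Ty A → ℤ) ⧸ pairs A))) := Submodule.finrank_mono hle
  have h2 : Module.finrank ℤ (Submodule.span ℤ (T : Set ((Ty A → ℤ) ⧸ pairs A))) ≤ T.card := finrank_span_finset_le_card T
  have h3 : T.card ≤ Fintype.card ι * S.card :=
    Finset.card_image_le.trans (by rw [Finset.card_product, Finset.card_univ])
  rw [finrank_hodge_mod_pairs A i₀] at h1
  exact h1.trans (h2.trans h3)

end GroupFree

/-! ### The Galois type `(ℤ/2 × A, (1,0))`: conjugation is `−1` modulo pairs -/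

section Transl

variable (A : Type) [AddCommGroup A] [Fintype A] [DecidableEq A]

/-- **Conjugation acts as `−1` modulo `P`**: `transl (1,0) w + w ∈ P` for every exponent vector `w`. [folklore] -/
theorem transl_one_zero_add_mem_pairs (w : Ty A → ℤ) : transl A (1, 0) w + w ∈ pairs A := by
  have hw : w = ∑ ψ, (Pi.single ψ (w ψ) : Ty A → ℤ) := (Finset.univ_sum_single w).symm
  rw [hw, ← translHom_apply, map_sum, ← Finset.sum_add_distrib]
  refine Submodule.sum_mem _ fun ψ _ => ?_
  rw [translHom_apply, transl_single, tw_one_zero]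
  have e : (Pi.single (ψ + 1) (w ψ) : Ty A → ℤ) + Pi.single ψ (w ψ) = w ψ • pairVec A ψ := by
    ext χ
    simp only [pairVec, Pi.add_apply, Pi.smul_apply, Pi.single_apply, smul_eq_mul]
    split_ifs <;> ring
  rw [e]
  exact Submodule.smul_mem _ _ (Submodule.subset_span ⟨ψ, rfl⟩)

/-- A translate by `(1, a)` is, modulo `P`, minus the translate by `(0, a)`. [folklore] -/
theorem transl_one_mem (a : A) (t : Ty A → ℤ) :
    transl A (1, a) t ∈ pairs A ⊔ Submodule.span ℤ {v | ∃ b : A, ∃ t' ∈ ({t} : Finset (Ty A → ℤ)), v = transl A (0, b) t'} := by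
  have hcomp : transl A (1, a) t = transl A (1, 0) (transl A (0, a) t) := by
    funext ψ
    simp only [transl, tw_tw]
    congr 2
    ext <;> simp
  have hP := transl_one_zero_add_mem_pairs A (transl A (0, a) t)
  have e : transl A (1, a) t = (transl A (1, 0) (transl A (0, a) t) + transl A (0, a) t) - transl A (0, a) t := by
    rw [hcomp, add_sub_cancel_right]
  rw [e]
  exact Submodule.sub_mem _ (Submodule.mem_sup_left hP)
    (Submodule.mem_sup_right (Submodule.subset_span ⟨a, t, Finset.mem_singleton_self t, rfl⟩))

/-- The `ℤ[G]`-span of `S` modulo pairs is the span of the `n` place translates: `P ⊔ ℤ⟨transl g t⟩ ≤ P ⊔ ℤ⟨transl (0,a) t⟩`. [folklore] -/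
theorem pairs_sup_span_transl_le (S : Finset (Ty A → ℤ)) :
    pairs A ⊔ Submodule.span ℤ {v | ∃ g : ZMod 2 × A, ∃ t ∈ S, v = transl A g t} ≤
      pairs A ⊔ Submodule.span ℤ {v | ∃ a : A, ∃ t ∈ S, v = transl A (0, a) t} := by
  refine sup_le le_sup_left (Submodule.span_le.mpr ?_)
  rintro _ ⟨⟨ε, a⟩, t, ht, rfl⟩
  have h01 : ∀ u : ZMod 2, u = 0 ∨ u = 1 := by decide
  rcases h01 ε with rfl | rfl
  · exact Submodule.mem_sup_right (Submodule.subset_span ⟨a, t, ht, rfl⟩)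
  · have hsub : {v : Ty A → ℤ | ∃ b : A, ∃ t' ∈ ({t} : Finset (Ty A → ℤ)), v = transl A (0, b) t'} ⊆
        {v | ∃ a : A, ∃ t ∈ S, v = transl A (0, a) t} := by
      rintro _ ⟨b, t', ht', rfl⟩
      rw [Finset.mem_singleton] at ht'
      exact ⟨b, t, ht, by rw [ht']⟩
    have hle : pairs A ⊔ Submodule.span ℤ {v : Ty A → ℤ | ∃ b : A, ∃ t' ∈ ({t} : Finset (Ty A → ℤ)), v = transl A (0, b) t'} ≤
        pairs A ⊔ Submodule.span ℤ {v | ∃ a : A, ∃ t ∈ S, v = transl A (0, a) t} :=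
      sup_le_sup_left (Submodule.span_mono hsub) (pairs A)
    exact hle (transl_one_mem A a t)

/-- **THE RANK LAW for the Galois type `(ℤ/2 × A, (1,0))`**: if the `G`-translates of a finite set `S` of vectors generate the Hodge
lattice modulo pairs, then `2^{n−1} − n ≤ n · |S|` (`n = |A|`), i.e. `μ(ℤ/2 × A) ≥ ⌈(2^{n−1} − n)/n⌉`, for every finite abelian `A`.
[folklore] -/
theorem rank_law_transl (S : Finset (Ty A → ℤ))
    (hS : hodge A ≤ pairs A ⊔ Submodule.span ℤ {v | ∃ g : ZMod 2 × A, ∃ t ∈ S, v = transl A g t}) :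
    2 ^ (Fintype.card A - 1) - Fintype.card A ≤ Fintype.card A * S.card :=
  rank_law A (0 : A) (fun a : A => transl A (0, a)) S (hS.trans (pairs_sup_span_transl_le A S))

/-- **The trivial companion upper bound**: the `2^{n−1} − n` basis faces themselves (one-element «orbits») generate `H` modulo pairs under
the `G`-action, so `⌈(2^{n−1} − n)/n⌉ ≤ μ(ℤ/2 × A) ≤ 2^{n−1} − n` for every finite abelian `A` with no certificate. [folklore] -/
theorem exists_faces_generate_transl (i₀ : A) :
    ∃ S : Finset (Ty A → ℤ), S.card ≤ 2 ^ (Fintype.card A - 1) - Fintype.card A ∧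
      (∀ t ∈ S, ∃ (φ : Ty A) (i j : A), i ≠ j ∧ t = faceVec A φ i j) ∧
      hodge A ≤ pairs A ⊔ Submodule.span ℤ {v | ∃ g : ZMod 2 × A, ∃ t ∈ S, v = transl A g t} := by
  classical
  haveI : Nonempty A := ⟨i₀⟩
  obtain ⟨sel, hsel⟩ := exists_selector A
  refine ⟨univ.image fun Q : BIdx A i₀ => bvec A sel Q.1, ?_, ?_, ?_⟩
  · rw [← card_BIdx A i₀, ← Finset.card_univ]
    exact Finset.card_image_le
  · intro t ht
    obtain ⟨Q, -, rfl⟩ := Finset.mem_image.mp ht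
    exact ⟨ind A Q.1, (sel Q.1).1, (sel Q.1).2, (hsel Q.1 Q.2.2).2.2, rfl⟩
  · rw [hodge_eq_pairs_sup_bSpan A i₀ hsel]
    refine sup_le_sup_left (Submodule.span_le.mpr ?_) _
    rintro _ ⟨Q, rfl⟩
    refine Submodule.subset_span ⟨0, bvec A sel Q.1, Finset.mem_image.mpr ⟨Q, Finset.mem_univ Q, rfl⟩, ?_⟩
    exact (transl_zero A _).symm

end Transl

/-! ## §3 The rank law in b17's model of record (`|A|` odd) -/

section Record

open Summit.HodgeConjecture.CorCM.Census.OddSliceFacesRecord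
open Summit.HodgeConjecture.CorCM.Census.OddDegreeParityLaw (Pt AbQ πQ φQ hodgeLattice)

variable (A : Type) [AddCommGroup A] [Fintype A] [DecidableEq A]

omit [DecidableEq A] in
/-- The inverse transport of a pair of b17's model is a pair. [folklore] -/
theorem pull_symm_pairVec (hA : Odd (Fintype.card A)) (x : Pt (AbQ A)) :
    (pull A hA).symm (OddDegreeParityLaw.pairVec x) = pairVec A (toTy A x) := by
  apply (pull A hA).injective
  rw [LinearEquiv.apply_symm_apply, pull_pairVec, ← toTyEquiv_apply A hA, Equiv.symm_apply_apply]

omit [DecidableEq A] in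
/-- The inverse transport of a Galois translate of b17's model is the Galois translate of the inverse transport. [folklore] -/
theorem pull_symm_transl (hA : Odd (Fintype.card A)) (g : ZMod 2 × A) (m : Pt (AbQ A) → ℤ) :
    (pull A hA).symm (OddDegreeParityLaw.transl (πQ A) g m) = transl A g ((pull A hA).symm m) := by
  apply (pull A hA).injective
  rw [LinearEquiv.apply_symm_apply, pull_transl, LinearEquiv.apply_symm_apply]

/-- **THE RANK LAW in the model of record** (`|A|` odd): if the `G`-translates of `S` generate b17's `hodgeLattice (πQ A) (φQ A)` modulo
pairs, then `2^{n−1} − n ≤ n · |S|` — the degree-free floor under b17's `oddSlice_law`. [folklore] -/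
theorem rank_law_record (hA : Odd (Fintype.card A)) (S : Finset (Pt (AbQ A) → ℤ))
    (hS : hodgeLattice (πQ A) (φQ A) ≤ OddDegreeParityLaw.pairs ⊔
      Submodule.span ℤ {v | ∃ g : ZMod 2 × A, ∃ t ∈ S, v = OddDegreeParityLaw.transl (πQ A) g t}) :
    2 ^ (Fintype.card A - 1) - Fintype.card A ≤ Fintype.card A * S.card := by
  classical
  set S' : Finset (Ty A → ℤ) := S.image (pull A hA).symm with hS'
  have hgen : hodge A ≤ pairs A ⊔ Submodule.span ℤ {v | ∃ g : ZMod 2 × A, ∃ t ∈ S', v = transl A g t} := by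
    intro v hv
    have hm : pull A hA v ∈ hodgeLattice (πQ A) (φQ A) := by
      rw [mem_hodgeLattice_iff A hA, LinearEquiv.symm_apply_apply]
      exact hv
    have hX := hS hm
    have hP : (OddDegreeParityLaw.pairs (Ab := AbQ A)).map ((pull A hA).symm : (Pt (AbQ A) → ℤ) →ₗ[ℤ] (Ty A → ℤ)) ≤ pairs A := by
      rw [Submodule.map_le_iff_le_comap]
      refine Submodule.span_le.mpr ?_
      rintro _ ⟨x, rfl⟩
      simp only [SetLike.mem_coe, Submodule.mem_comap, LinearEquiv.coe_coe, pull_symm_pairVec]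
      exact Submodule.subset_span ⟨_, rfl⟩
    have hF : (Submodule.span ℤ {v | ∃ g : ZMod 2 × A, ∃ t ∈ S, v = OddDegreeParityLaw.transl (πQ A) g t}).map
        ((pull A hA).symm : (Pt (AbQ A) → ℤ) →ₗ[ℤ] (Ty A → ℤ)) ≤
        Submodule.span ℤ {v | ∃ g : ZMod 2 × A, ∃ t ∈ S', v = transl A g t} := by
      rw [Submodule.map_le_iff_le_comap]
      refine Submodule.span_le.mpr ?_
      rintro _ ⟨g, t, ht, rfl⟩
      simp only [SetLike.mem_coe, Submodule.mem_comap, LinearEquiv.coe_coe, pull_symm_transl]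
      exact Submodule.subset_span ⟨g, _, Finset.mem_image_of_mem _ ht, rfl⟩
    have hv' : v = (pull A hA).symm (pull A hA v) := ((pull A hA).symm_apply_apply v).symm
    rw [hv']
    obtain ⟨a, ha, b, hb, hab⟩ := Submodule.mem_sup.mp hX
    rw [← hab, map_add]
    exact Submodule.add_mem _ (Submodule.mem_sup_left (hP ⟨a, ha, rfl⟩)) (Submodule.mem_sup_right (hF ⟨b, hb, rfl⟩))
  exact (rank_law_transl A S' hgen).trans (Nat.mul_le_mul_left _ Finset.card_image_le)

end Record

end Summit.HodgeConjecture.CorCM.Census.GroupFreeFaceBasisRank
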